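import Summits.ResolutionOfSingularities.ResolutionOfSingularities.Theorems.PurelyInseparableDim4SwapTransportWindowStepSharpPrime
import Summits.ResolutionOfSingularities.ResolutionOfSingularities.Theorems.PurelyInseparableDim4FreeTail
import HarnessLib
import HarnessLib.Audit.Tags

/-!
# Purely inseparable four-folds — THE ♯-VIRTUAL WINDOW FOLLOWS THE REAL CHAIN, EVERY PRIME: the pure virtual slot chain carrying the ♯-frame
# shadows `T` real steps of any kind, with a one-step look-ahead (cell `res-dim4-pi`, K2(p) lane, rung-1 POWER-CONE LINE «light pair of
# TAIL(p, p−1, 3) ∀ p», flagless branch, FILE ♯7 part I♯ = W5a §2 with the ♯-frame; seat res-dim4-typ-1 g6)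

[OURS · counted 0 · cell `res-dim4-pi` · K2(p) lane (holder res-dim4-p-12 g5, rulings g5-23 / g5-26 / g5-27); res-dim4-p-3 g6's MEMO FLAGLESS♯
and port plan §6, res-dim4-typ-1 g6's design note (bus 2026-08-29 14:20Z).]  Nothing here proves K2(p) for any `p`, any TAIL(p, p−1, 3),
FLAGLESS♯, `NoIsolatedTrap p p`, the Cossart–Jannsen–Saito theorem or resolution of singularities in dimension ≥ 4 / characteristic `p` —
NOT proved.  AI kernel work, weaker than expert review.  Transport bookkeeping about OUR frame; kills nothing by itself.  ROW `c` and the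
pinning `hVT` BY VALUE (holder g5-26): the ♯-flag of the row is the residual's `x_λ²x_μ²u^{d−2−c}x_f^c` (`c = 0` is the `d = 6` witness
position of the memo's (U♯)); the level-`k` hierarchy of res-dim4-p-3's §7′ swaps in through S♯a the same way.

**`virtual_iterate_sharp_prime`** — from an ENTRY at real time `k` (relation along `π₀` at precision `M`, the ♯-frame of `Bs 0` at jet `N`:
order `d + 2`, `r = x_λx_μ ∣ F`, `resForm = a·x_f^d` + support dress, exact ledger, regime R in both slots, LAYER, dead row `(u, f) = (d − 3, 0)`
below `N` (`(u, f) = (d − 3 − c, c)`), row ♯-flag `≠ 0`, isolated, `e_G = 3`), the real chain witnessed (rotations allowed) and in regime up to `k + T + 1` (isolated with a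
common certificate level `Nc`, order `d + 2`, `e_G = 3`, weights `≤ 1` of degree `2`, `x^r ∣ F`), the virtual data `(πs, Bs, ℓs)` of W5a's
recursion rule, and budgets `Nc + 3p + 2 + p·T ≤ M`, `d + 5 + d·T ≤ N`: at every `t ≤ T` the relation `(πs t, c (k+t), Bs t)` holds at
precision `M − p·t`, `(c (k+t)).r = e_{πs t λ} + e_{πs t μ}`, and `Bs t` carries the ♯-frame at jet `N − d·t` — S♯ `virtual_step_sharp_any_prime`
iterated, the look-ahead consuming the real step `k + t + 1` at stage `t`.
[cite: Hauser2010, §§F–G] [cite: CossartJannsenSaito2020, Thm. 3.14, Lemma 13.2]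
bears_on: LADDER-RESOLUTION:D157-DOOR2 (res-dim4-pi · K2(p) · power cones · flagless branch ♯7 ♯-window iteration).  Supports
stmt-ResolutionOfSingularities-16155 (helper).
-/

set_option linter.dupNamespace false -- mandated namespace of this single-conjunct summit

noncomputable section

namespace Summit.ResolutionOfSingularities.ResolutionOfSingularities.Theorems.PIDim4

namespace SwapTransport

open MvPolynomial Finset
open Literature.AlgebraicGeometry.Resolution
open Literature.AlgebraicGeometry.Resolution.CentreBlowup
open Literature.AlgebraicGeometry.Resolution.Hauser2010
open Literature.AlgebraicGeometry.Resolution.HauserPerlega2019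

variable {K : Type} [Field K] [DecidableEq K]

/-- **THE ♯-VIRTUAL WINDOW FOLLOWS THE REAL CHAIN, every prime** (module docstring). [OURS] [cite: Hauser2010, §§F–G]
[cite: CossartJannsenSaito2020, Thm. 3.14, Lemma 13.2] -/
theorem virtual_iterate_sharp_prime (p : ℕ) [Fact p.Prime] [CharP K p] {d ef : ℕ} (hdp : d + 1 = p) (hef : ef + 3 ≤ d)
    {la mu u f : Fin 4} (hlm : la ≠ mu) (hlu : la ≠ u) (hlf : la ≠ f) (hmu : mu ≠ u) (hmf : mu ≠ f) (huf : u ≠ f)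
    (hVT : ∀ (x y : Fin 4) (B : State K) (β : K), x ≠ y → x ≠ u → x ≠ f → y ≠ u → y ≠ f →
      ordZero B.F = ((d + 2 : ℕ) : ℕ∞) → (∀ e ∈ B.F.support, e f = ef → 3 ≤ e x) →
      coeff (Finsupp.single x 4 + Finsupp.single y 3 + Finsupp.single u (d - 3 - ef) + Finsupp.single f ef) B.F = 0 →
      coeff (Finsupp.single x 3 + Finsupp.single y 3 + Finsupp.single u (d - 2 - ef) + Finsupp.single f ef) B.F ≠ 0 →
      coeff (Finsupp.single x 3 + Finsupp.single y 3 + Finsupp.single u (d - 3 - ef) + Finsupp.single f ef)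
        (CentreBlowup.step p Finset.univ x (Function.update (0 : Fin 4 → K) u β) B).F = 0 → β = 0)
    {c : ℕ → State K} {j : ℕ → Fin 4} {b : ℕ → Fin 4 → K} (hw : FreeTail.IsWitnessedChain p c j b) {k Nc T : ℕ}
    (hisoR : ∀ t, t ≤ T + 1 → IsIsolated p (c (k + t)).F)
    (hcert : ∀ t, t ≤ T + 1 → originIdeal K ^ Nc ≤ singLocusIdeal p (c (k + t)).F ⊔ originIdeal K ^ (Nc + 1))
    (hoR : ∀ t, t ≤ T + 1 → ordZero (c (k + t)).F = ((d + 2 : ℕ) : ℕ∞))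
    (he3R : ∀ t, t ≤ T + 1 → Module.finrank K (ResCone.resVertex (c (k + t))) = 3)
    (hwtR : ∀ t, t ≤ T + 1 → (∀ i, (c (k + t)).r i ≤ 1) ∧ (c (k + t)).r.degree = 2)
    (hdivR : ∀ t, t ≤ T + 1 → ∀ e ∈ (c (k + t)).F.support, (c (k + t)).r ≤ e)
    {πs : ℕ → Equiv.Perm (Fin 4)} {Bs : ℕ → State K} {ℓs : ℕ → Fin 4}
    (hBs : ∀ t, Bs (t + 1) = CentreBlowup.step p Finset.univ (ℓs t) 0 (Bs t))
    (hℓs : ∀ t, ℓs t = if j (k + t) = πs t la then la else if j (k + t) = πs t mu then mu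
      else if b (k + t) (πs t la) ≠ 0 then la else mu)
    (hπs : ∀ t, πs (t + 1) = if j (k + t) = πs t la ∨ j (k + t) = πs t mu then πs t
      else (Equiv.swap (ℓs t) ((πs t).symm (j (k + t)))).trans (πs t))
    {M N : ℕ} (hM : Nc + 3 * p + 2 + p * T ≤ M) (hN : d + 5 + d * T ≤ N)
    (hrel0 : ∃ (θ e : Fin 4 → MvPolynomial (Fin 4) K) (U E : MvPolynomial (Fin 4) K),
      θ (πs 0 la) = X la * e la ∧ θ (πs 0 mu) = X mu * e mu ∧ constantCoeff (e la) ≠ 0 ∧ constantCoeff (e mu) ≠ 0 ∧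
      constantCoeff (θ (πs 0 u)) = 0 ∧ constantCoeff (θ (πs 0 f)) = 0 ∧
      coeff (Finsupp.single u 1) (θ (πs 0 u)) * coeff (Finsupp.single f 1) (θ (πs 0 f)) -
        coeff (Finsupp.single f 1) (θ (πs 0 u)) * coeff (Finsupp.single u 1) (θ (πs 0 f)) ≠ 0 ∧
      constantCoeff U ≠ 0 ∧ E ∈ originIdeal K ^ M ∧ (Bs 0).F = deletePthPowers p (U ^ p * aeval θ (c k).F) + E)
    (hrA0 : (c k).r = Finsupp.single (πs 0 la) 1 + Finsupp.single (πs 0 mu) 1)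
    (hfr0 : ordZero (Bs 0).F = ((d + 2 : ℕ) : ℕ∞) ∧ (Bs 0).r = Finsupp.single la 1 + Finsupp.single mu 1 ∧
      (∀ e ∈ (Bs 0).F.support, (Bs 0).r ≤ e) ∧ (∃ a : K, a ≠ 0 ∧ ResCone.resForm (Bs 0) = C a * X f ^ d) ∧
      (∀ e ∈ (Bs 0).F.support, e.degree = d + 2 →
        e = Finsupp.single la 1 + Finsupp.single mu 1 + Finsupp.single u 0 + Finsupp.single f d) ∧
      (∀ e ∈ (Bs 0).F.support, e f ≤ d - 1 → 2 ≤ e la ∧ 2 ≤ e mu) ∧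
      (∀ e ∈ (Bs 0).F.support, e f + 2 ≤ d → 3 ≤ e la) ∧ (∀ e ∈ (Bs 0).F.support, e f + 2 ≤ d → 3 ≤ e mu) ∧
      (∀ E : Fin 4 →₀ ℕ, E.degree = d + 3 → E f + 2 ≤ d → coeff E (Bs 0).F = 0) ∧
      (∀ e ∈ (Bs 0).F.support, e.degree < N → ¬ (e u = d - 3 - ef ∧ e f = ef)) ∧
      coeff (Finsupp.single la 3 + Finsupp.single mu 3 + Finsupp.single u (d - 2 - ef) + Finsupp.single f ef) (Bs 0).F ≠ 0 ∧
      IsIsolated p (Bs 0).F ∧ Module.finrank K (ResCone.resVertex (Bs 0)) = 3) :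
    ∀ t, t ≤ T →
      (∃ (θ e : Fin 4 → MvPolynomial (Fin 4) K) (U E : MvPolynomial (Fin 4) K),
        θ (πs t la) = X la * e la ∧ θ (πs t mu) = X mu * e mu ∧ constantCoeff (e la) ≠ 0 ∧ constantCoeff (e mu) ≠ 0 ∧
        constantCoeff (θ (πs t u)) = 0 ∧ constantCoeff (θ (πs t f)) = 0 ∧
        coeff (Finsupp.single u 1) (θ (πs t u)) * coeff (Finsupp.single f 1) (θ (πs t f)) -
          coeff (Finsupp.single f 1) (θ (πs t u)) * coeff (Finsupp.single u 1) (θ (πs t f)) ≠ 0 ∧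
        constantCoeff U ≠ 0 ∧ E ∈ originIdeal K ^ (M - p * t) ∧
        (Bs t).F = deletePthPowers p (U ^ p * aeval θ (c (k + t)).F) + E) ∧
      (c (k + t)).r = Finsupp.single (πs t la) 1 + Finsupp.single (πs t mu) 1 ∧
      (ordZero (Bs t).F = ((d + 2 : ℕ) : ℕ∞) ∧ (Bs t).r = Finsupp.single la 1 + Finsupp.single mu 1 ∧
        (∀ e ∈ (Bs t).F.support, (Bs t).r ≤ e) ∧ (∃ a : K, a ≠ 0 ∧ ResCone.resForm (Bs t) = C a * X f ^ d) ∧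
        (∀ e ∈ (Bs t).F.support, e.degree = d + 2 →
          e = Finsupp.single la 1 + Finsupp.single mu 1 + Finsupp.single u 0 + Finsupp.single f d) ∧
        (∀ e ∈ (Bs t).F.support, e f ≤ d - 1 → 2 ≤ e la ∧ 2 ≤ e mu) ∧
        (∀ e ∈ (Bs t).F.support, e f + 2 ≤ d → 3 ≤ e la) ∧ (∀ e ∈ (Bs t).F.support, e f + 2 ≤ d → 3 ≤ e mu) ∧
        (∀ E : Fin 4 →₀ ℕ, E.degree = d + 3 → E f + 2 ≤ d → coeff E (Bs t).F = 0) ∧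
        (∀ e ∈ (Bs t).F.support, e.degree < N - d * t → ¬ (e u = d - 3 - ef ∧ e f = ef)) ∧
        coeff (Finsupp.single la 3 + Finsupp.single mu 3 + Finsupp.single u (d - 2 - ef) + Finsupp.single f ef) (Bs t).F ≠ 0 ∧
        IsIsolated p (Bs t).F ∧ Module.finrank K (ResCone.resVertex (Bs t)) = 3) := by
  intro t
  induction t with
  | zero =>
    intro _
    simp only [Nat.mul_zero, Nat.sub_zero, Nat.add_zero]
    exact ⟨hrel0, hrA0, hfr0⟩
  | succ t ih =>
    intro ht
    obtain ⟨hrel, hrA, hfr⟩ := ih (by omega)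
    -- the real step `k + t` and the look-ahead step `k + t + 1`
    obtain ⟨-, hbj, -, -, hcs⟩ := hw (k + t)
    have hcs' : c (k + (t + 1)) = CentreBlowup.step p Finset.univ (j (k + t)) (b (k + t)) (c (k + t)) := hcs
    obtain ⟨-, hbj₂, -, -, hcs₂⟩ := hw (k + (t + 1))
    have hcs₂' : c (k + (t + 2)) = CentreBlowup.step p Finset.univ (j (k + (t + 1))) (b (k + (t + 1))) (c (k + (t + 1))) := hcs₂
    have hpt : p * t + p = p * (t + 1) := (Nat.mul_succ p t).symm
    have hdt : d * t + d = d * (t + 1) := (Nat.mul_succ d t).symm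
    have hpT : p * (t + 1) ≤ p * T := Nat.mul_le_mul_left p ht
    have hdT : d * (t + 1) ≤ d * T := Nat.mul_le_mul_left d ht
    obtain ⟨ℓ, π', -, hℓeq, hπ'eq, hrel', hrA', hfr'⟩ := virtual_step_sharp_any_prime p hdp hef hlm hlu hlf hmu hmf huf hVT hrel hrA
      (hoR t (by omega)) hfr hbj hcs' (hisoR (t + 1) (by omega)) (hcert (t + 1) (by omega)) (hoR (t + 1) (by omega))
      (he3R (t + 1) (by omega)) (hwtR (t + 1) (by omega)).1 (hwtR (t + 1) (by omega)).2 (hdivR (t + 1) (by omega)) hbj₂ hcs₂'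
      (hisoR (t + 2) (by omega)) (hcert (t + 2) (by omega)) (hoR (t + 2) (by omega)) (he3R (t + 2) (by omega))
      (hwtR (t + 2) (by omega)).1 (hwtR (t + 2) (by omega)).2 (hdivR (t + 2) (by omega)) (by omega) (by omega)
    have hℓt : ℓs t = ℓ := by rw [hℓs t, hℓeq]
    have hπt : πs (t + 1) = π' := by rw [hπs t, hπ'eq, hℓt]
    have hBt : Bs (t + 1) = CentreBlowup.step p Finset.univ ℓ 0 (Bs t) := by rw [hBs t, hℓt]
    have hM5 : M - p * t - p = M - p * (t + 1) := by omega
    have hN4 : N - d * t - d = N - d * (t + 1) := by omega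
    rw [hπt, hBt, ← hM5, ← hN4]
    exact ⟨hrel', hrA', hfr'⟩

end SwapTransport

end Summit.ResolutionOfSingularities.ResolutionOfSingularities.Theorems.PIDim4

end
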